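import Literature.Probability.LatticeModels.KCSignConditionScaleEnd
import HarnessLib

/-!
# The sign-condition argument: the limit

Topic `Literature/Probability/LatticeModels`. The contradiction of the Chelkak–Smirnov
sign-condition argument for a fixed continuum configuration `cfg : KCSignConfig Ω G Bad` along a
sequence of meshes `δ_n → 0⁺`: if the lattice data eventually cover every compact subset of `Ω`,
see the boundary (frozen sites near every boundary point), and the lattice functions `u_n` are
sub-harmonic for the boundary-modified Laplacian off `W`, non-negative at frozen-corner plaquettes
in `G`, bounded by `M_u N_n` in `G`, eventually non-positive on each `Kmid μ` and at most `-η₀ N_n`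
on `Kflat`, then `False` (`KCSignConfig.false_of_limit`).  The proof chooses the end length `μ`
so small that the right-hand side of `ScaleHyp.one_mesh_ineq` is below its left-hand side, then a
mesh `δ_n` at which all the scale hypotheses hold.

All `[folklore]` glue; no named fact.

## References

* D. Chelkak, S. Smirnov, Invent. Math. 189 (2012) = arXiv:0910.2045, proof of Thm. 6.1, Remark 6.3. [ChelkakSmirnov2012Ising]
-/

noncomputable section

open Set Metric Filter Topology

namespace Literature.Probability.LatticeModels

open Site WeakBeurling Literature.Topology.PlaneTopology

namespace KCSignConfig

variable {Ω G Bad : Set ℂ} (cfg : KCSignConfig Ω G Bad)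

/-! ### Compactness of `Kbulk` and its position inside `Ω` -/

/-- `Kbulk μ` is compact. [folklore] -/
theorem isCompact_Kbulk (μ : ℝ) : IsCompact (cfg.Kbulk μ) := by
  refine ((((Finset.isCompact_biUnion _ fun j _ => isCompact_supBox _ _).union ?_).union ?_).union ?_).union
    (isCompact_iUnion fun e => isCompact_l1ball _ _)
  · -- the clear box is a closed subset of a closed ball
    refine (isCompact_closedBall cfg.pmid (2 * (2 * cfg.ℓ))).of_isClosed_subset ?_ fun w hw => ?_
    · have : {w : ℂ | |dirCoord cfg.km (w - cfg.pmid)| ≤ 2 * cfg.ℓ ∧ |dirCoord (cfg.km + 1) (w - cfg.pmid)| ≤ 2 * cfg.ℓ} =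
          (fun w => dirCoord cfg.km (w - cfg.pmid)) ⁻¹' Icc (-(2 * cfg.ℓ)) (2 * cfg.ℓ) ∩
            (fun w => dirCoord (cfg.km + 1) (w - cfg.pmid)) ⁻¹' Icc (-(2 * cfg.ℓ)) (2 * cfg.ℓ) := by
        ext w; simp [abs_le]
      rw [this]
      refine (isClosed_Icc.preimage ?_).inter (isClosed_Icc.preimage ?_) <;> unfold dirCoord <;> fun_prop
    · rw [mem_closedBall, dist_eq_norm]
      obtain ⟨h1, h2⟩ := hw
      linarith [norm_le_abs_dirCoord_add cfg.km (w - cfg.pmid)]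
  · exact Metric.isCompact_of_isClosed_isBounded isClosed_cthickening
      ((((isCompact_range cfg.Pz.continuous).isBounded.union (isCompact_range cfg.Pw.continuous).isBounded).union
        cfg.W_bdd.closure).cthickening)
  · exact Metric.isCompact_of_isClosed_isBounded isClosed_cthickening cfg.isCompact_Mset.isBounded.cthickening

/-- `Kbulk μ ⊆ Ω` for `μ > 0`. [folklore] -/
theorem Kbulk_subset {μ : ℝ} (hμ : 0 < μ) : cfg.Kbulk μ ⊆ Ω := by
  rintro w ((((hw | hw) | hw) | hw) | hw)
  · simp only [Set.mem_iUnion, Finset.mem_range] at hw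
    obtain ⟨j, hj, hw⟩ := hw
    exact (cfg.window_subset j (Nat.lt_succ_iff.1 hj) hw).1
  · exact (cfg.clearBox_subset hw).1
  · exact cfg.paths_thick_subset (cthickening_mono (by linarith [cfg.d₀_pos]) _ hw)
  · exact (cfg.mid_thick_subset (cthickening_mono (by linarith [cfg.rM_pos]) _ hw)).1
  · simp only [Set.mem_iUnion, Set.mem_setOf_eq] at hw
    obtain ⟨e, he⟩ := hw
    exact cfg.diamond_subset e (by simp only [Set.mem_setOf_eq]; linarith)

/-- The touch points of the end diamonds are boundary points of `Ω`. [folklore] -/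
theorem exists_touch_frontier (e : Fin 2) : ∃ p ∈ frontier Ω, l1norm (p - cfg.z₀ e) = cfg.mInf e := by
  obtain ⟨p, hpΩ, hp⟩ := cfg.touch e
  refine ⟨p, ?_, hp⟩
  rw [frontier_eq_closure_inter_closure]
  refine ⟨?_, subset_closure hpΩ⟩
  -- `p` is the limit of the points `z₀ + t (p - z₀)`, `t < 1`, of the open diamond
  rw [Metric.mem_closure_iff]
  intro ε hε
  have hm := cfg.mInf_pos e
  set t : ℝ := max (1 / 2) (1 - ε / (2 * (l1norm (p - cfg.z₀ e) + 1))) with ht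
  have ht1 : t < 1 := by
    rw [ht, max_lt_iff]; refine ⟨by norm_num, ?_⟩
    have : 0 < ε / (2 * (l1norm (p - cfg.z₀ e) + 1)) := by have := l1norm_nonneg (p - cfg.z₀ e); positivity
    linarith
  have ht0 : 0 < t := lt_of_lt_of_le (by norm_num) (le_max_left _ _)
  refine ⟨cfg.z₀ e + (t : ℂ) * (p - cfg.z₀ e), cfg.diamond_subset e ?_, ?_⟩
  · simp only [Set.mem_setOf_eq, add_sub_cancel_left]
    rw [l1norm_real_smul, abs_of_pos ht0, hp]
    exact mul_lt_of_lt_one_left hm ht1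
  · rw [dist_eq_norm]
    have : p - (cfg.z₀ e + (t : ℂ) * (p - cfg.z₀ e)) = ((1 - t : ℝ) : ℂ) * (p - cfg.z₀ e) := by push_cast; ring
    rw [this, norm_mul, Complex.norm_real, Real.norm_eq_abs, abs_of_pos (by linarith)]
    have h1 : 1 - t ≤ ε / (2 * (l1norm (p - cfg.z₀ e) + 1)) := by rw [ht]; have := le_max_right (1 / 2) (1 - ε / (2 * (l1norm (p - cfg.z₀ e) + 1))); linarith
    have h2 : ‖p - cfg.z₀ e‖ ≤ l1norm (p - cfg.z₀ e) := norm_le_l1norm _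
    have h3 := l1norm_nonneg (p - cfg.z₀ e)
    calc (1 - t) * ‖p - cfg.z₀ e‖ ≤ ε / (2 * (l1norm (p - cfg.z₀ e) + 1)) * l1norm (p - cfg.z₀ e) :=
          mul_le_mul h1 h2 (norm_nonneg _) (by positivity)
      _ < ε := by
        rw [div_mul_eq_mul_div, div_lt_iff₀ (by positivity)]
        nlinarith

/-! ### The limit -/

/-- **The contradiction of the sign-condition argument.** [cite: ChelkakSmirnov2012Ising, proof of Thm. 6.1 and Remark 6.3] -/
theorem false_of_limit (δ : ℕ → ℝ) (hδ : ∀ n, 0 < δ n) (hδ0 : Tendsto δ atTop (𝓝 0))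
    (Λ : ℕ → Finset (Site 2)) (hΛ : ∀ n, HoleFree (↑(Λ n) : Set (Site 2)))
    (u : ℕ → Site 2 → ℝ) (N : ℕ → ℝ) (hN : ∀ n, 0 < N n) {Mu η₀ : ℝ} (hMu : 0 ≤ Mu) (hη₀ : 0 < η₀)
    (hSub : ∀ n, ∀ f : Site 2, (∃ i : Fin 4, f + cornerOff i ∈ Λ n) → ((δ n : ℝ) : ℂ) * plaqCentre f ∉ cfg.W →
      0 ≤ kcModLaplacian (Λ n) (fun _ => 0) (u n) f)
    (hU0 : ∀ n, ∀ f : Site 2, (∃ i : Fin 4, f + cornerOff i ∉ Λ n) → ((δ n : ℝ) : ℂ) * plaqCentre f ∈ G → 0 ≤ u n f)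
    (hUbd : ∀ n, ∀ f : Site 2, ((δ n : ℝ) : ℂ) * plaqCentre f ∈ G → u n f ≤ Mu * N n)
    (hUmid : ∀ μ : ℝ, 0 < μ → ∀ᶠ n in atTop, ∀ f : Site 2, ((δ n : ℝ) : ℂ) * plaqCentre f ∈ cfg.Kmid μ → u n f ≤ 0)
    (hUflat : ∀ᶠ n in atTop, ∀ f : Site 2, ((δ n : ℝ) : ℂ) * plaqCentre f ∈ cfg.Kflat → u n f ≤ -(η₀ * N n))
    (hbulk : ∀ K : Set ℂ, IsCompact K → K ⊆ Ω → ∀ᶠ n in atTop, ∀ v : Site 2, ((δ n : ℝ) : ℂ) * toComplex v ∈ K → v ∈ Λ n)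
    (hvis : ∀ ε : ℝ, 0 < ε → ∀ᶠ n in atTop, ∀ p ∈ frontier Ω, ∃ b : Site 2, b ∉ Λ n ∧ dist (((δ n : ℝ) : ℂ) * toComplex b) p ≤ ε) :
    False := by
  -- the constants of the inequality
  set X : ℝ := modKappa * (maneuverConst / 2) ^ (cfg.J + 1) / 16 with hX
  have hXpos : 0 < X := by have := modKappa_pos; have := maneuverConst_pos; positivity
  set Mu' : ℝ := Mu + 1 with hMu'
  have hMu'pos : 0 < Mu' := by linarith
  have hA := endRunConst_pos
  have hγ := endDecayExp_pos
  -- choose the end length `μ`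
  set τ : ℝ := η₀ * X / (2 * (Mu' * (endRunConst * 2))) with hτ
  have hτpos : 0 < τ := by positivity
  set s : ℝ := min (1 / 2) (τ ^ (1 / endDecayExp)) with hs
  have hspos : 0 < s := lt_min (by norm_num) (Real.rpow_pos_of_pos hτpos _)
  have hsγ : s ^ endDecayExp ≤ τ := by
    calc s ^ endDecayExp ≤ (τ ^ (1 / endDecayExp)) ^ endDecayExp := Real.rpow_le_rpow hspos.le (min_le_right _ _) hγ.le
      _ = τ := by rw [one_div, Real.rpow_inv_rpow hτpos.le hγ.ne']
  set μ : ℝ := min cfg.μmax (s * cfg.dR / 2) with hμdef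
  have hdR := cfg.dR_pos
  have hμpos : 0 < μ := lt_min μmax_pos (by positivity)
  have hμle : μ ≤ cfg.μmax := min_le_left _ _
  have hμs : 2 * μ / cfg.dR ≤ s := by
    rw [div_le_iff₀ hdR]; have := min_le_right cfg.μmax (s * cfg.dR / 2); linarith
  -- the eventual hypotheses at end length `μ`
  have hδev : ∀ᶠ n in atTop, δ n ≤ min (cfg.δmax μ) μ := by
    have hpos : 0 < min (cfg.δmax μ) μ := lt_min (δmax_pos hμpos) hμpos
    exact (hδ0.eventually (Iic_mem_nhds hpos)).mono fun n hn => hn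
  have hε : 0 < min (μ / 16) cfg.κ := lt_min (by positivity) cfg.κ_pos
  obtain ⟨n, ⟨⟨hn1, hn2⟩, hn3⟩, hn4, hn5⟩ := (((hδev.and (hbulk _ (cfg.isCompact_Kbulk μ) (cfg.Kbulk_subset hμpos))).and
    (hvis _ hε)).and ((hUmid μ hμpos).and hUflat)).exists
  -- the scale hypotheses at mesh `δ n`
  have H : ScaleHyp cfg (δ n) (Λ n) μ :=
    { μ_pos := hμpos
      μ_le := hμle
      δ_pos := hδ n
      δ_le := hn1.trans (min_le_left _ _)
      holeFree := hΛ n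
      bulk := hn2
      vis_end := fun e => by
        obtain ⟨p, hp, hpl⟩ := cfg.exists_touch_frontier e
        obtain ⟨b, hb, hbd⟩ := hn3 p hp
        refine ⟨b, hb, ?_⟩
        have h1 : l1norm (((δ n : ℝ) : ℂ) * toComplex b - cfg.z₀ e) ≤ l1norm (((δ n : ℝ) : ℂ) * toComplex b - p) + l1norm (p - cfg.z₀ e) := by
          have := l1norm_add_le (((δ n : ℝ) : ℂ) * toComplex b - p) (p - cfg.z₀ e)
          rwa [sub_add_sub_cancel] at this
        have h2 : l1norm (((δ n : ℝ) : ℂ) * toComplex b - p) ≤ 2 * dist (((δ n : ℝ) : ℂ) * toComplex b) p := by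
          rw [dist_eq_norm]; exact l1norm_le_two_mul_norm _
        have h3 := min_le_left (μ / 16) cfg.κ
        linarith
      vis_seed := by
        obtain ⟨q, hq, hqd, -⟩ := cfg.seed_near
        obtain ⟨b, hb, hbd⟩ := hn3 q hq
        refine ⟨b, hb, ?_⟩
        have h3 := min_le_right (μ / 16) cfg.κ
        linarith [dist_triangle (((δ n : ℝ) : ℂ) * toComplex b) q cfg.zStar] }
  -- the one-mesh inequality and the contradiction
  have key := H.one_mesh_ineq (hN n) hMu'pos.le hη₀.le (hSub n) (hU0 n) (fun f hf => (hUbd n f hf).trans (by nlinarith [hN n])) hn4 hn5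
  have hratio : ((μ + δ n) / cfg.dR) ^ endDecayExp ≤ τ := by
    refine le_trans (Real.rpow_le_rpow (by have := hδ n; positivity) ?_ hγ.le) hsγ
    have : δ n ≤ μ := hn1.trans (min_le_right _ _)
    calc (μ + δ n) / cfg.dR ≤ 2 * μ / cfg.dR := by rw [div_le_div_iff_of_pos_right hdR]; linarith
      _ ≤ s := hμs
  have : Mu' * (endRunConst * (2 * ((μ + δ n) / cfg.dR) ^ endDecayExp)) ≤ η₀ * X / 2 := by
    calc Mu' * (endRunConst * (2 * ((μ + δ n) / cfg.dR) ^ endDecayExp)) = (Mu' * (endRunConst * 2)) * ((μ + δ n) / cfg.dR) ^ endDecayExp := by ring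
      _ ≤ (Mu' * (endRunConst * 2)) * τ := mul_le_mul_of_nonneg_left hratio (by positivity)
      _ = η₀ * X / 2 := by rw [hτ]; field_simp
  have hpos : 0 < η₀ * X := mul_pos hη₀ hXpos
  rw [← hX] at key
  linarith

end KCSignConfig

end Literature.Probability.LatticeModels
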